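import Summits.QuantumFields.BalabanUV.Beta.GAN24.TorusCovering

/-!
# G-an2-4 ∕ (CONV-C), INTERFACE REQUEST #12 (B5-1115-TABLE), row F12-E2r — supplier (B):
# BAŁABAN'S OPERATORS COMMUTE WITH THE PULL-BACK ALONG A COVERING OF TORI — `∇`, `∇*`, `Δ`, `∂`, `∂*`, `Q′_k`, `Q′*_k`, `Q_k`,
# `Q*_k`, the mean, `Δ⁻¹` (scalar, on the complement of constants), `(Q′Δ⁻²Q′* + C)⁻¹`, `P = PcT`, `Δ_a = DeltaA` AND `Δ_a⁻¹`

G-an2-4 formalisation swarm `b2b-balaban-gan24-formalise-*`, leaf prover 02 (gen 42), crux team (2) under the coordinator ruling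
«YM REDIRECT» (e34b3e0c); § II.F of `GAN24/Formal/LEAVES.md`, row **F12-E2r** (the RECTANGULAR-torus half of (E2)
`B5Prop12Entries110.Entry110Grad d 1`), ROAD (r2) «covering ∕ periodisation bridge» IN POSITION SPACE.  Supplier (A)
`TorusCovering` gave the covering `cov h : Tor N′ → Tor N` (`N ∣ N′` coordinatewise) and the pull-back matrices `pull h`, `pullV h`.
THIS FILE proves, for every operator `X` entering `B5DeltaA169.DeltaA n M a = Δ − ∂·P·∂* + a·Q*Q` ((1.69)∕(1.73)), the INTERTWINING
`X(M′) * pull = pull * X(M)` — so that `Δ_a(M′)⁻¹ ∘ pull = pull ∘ Δ_a(M)⁻¹`: the propagator on ANY torus `M` is read off the propagator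
on any torus `M′` it divides (e.g. the CUBIC torus `M′ = (Π_μ M_μ, …, Π_μ M_μ)`), which is where the tree's estimates live.

## Method (no Fourier analysis)
LOCAL operators (`shiftS`, `sdiff`, `LapS`, `GradOp`, `shiftM`, `fdiff`, `Lap` and their adjoints) intertwine because `cov` is a group
homomorphism fixing the unit vectors; BLOCK-LOCAL ones (`QsOp`, `QvOp` and adjoints) because `cov (n·ỹ + j) = n·cov(ỹ) + j`
(`TorusCovering.cov_bpt`) and the weights `η^d = n^{-d}` depend on `n` only; the MEAN `Cavg` because the fibres are uniform
(`TorusCovering.sum_comp_cov`, `card_cover`).  The two NON-LOCAL factors need no symbol calculus: `Δ⁻¹ = LapSinv` is CHARACTERISED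
algebraically by `Δ·Δ⁻¹f = f` and `Σ Δ⁻¹f = 0` for `f ⊥ 1`, `Δ⁻¹(const) = 0` (`B5LaplaceInverse.LapS_LapSinv_of_orth` ∕ `LapSinv_LapS_of_orth` ∕
`sum_LapSinv` ∕ `LapSinv_const` BY NAME), and these data are preserved by the pull-back; inverses (`Minv = Kmat⁻¹`, `DeltaA⁻¹`) intertwine by
the one-line algebra `X′·P = P·X, IsUnit X, IsUnit X′ ⟹ X′⁻¹·P = P·X⁻¹` (`itw_inv`).

## Contents (0 `def`, 0 `def … : Prop`, 0 cite, 0 sorry)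
§0 generic intertwining algebra `itw_*`; §1 scalar local operators; §2 vector local operators (over `B5G183FreeRowSum.fdiff_mulVec` ∕
`fdiff_conjTranspose_mulVec` BY NAME); §3 block averages and the mean; §4 `LapSinv`; §5 `Mop`, `Kmat`, `Minv`, `PcT`; §6 **`DeltaA_mul_pullV`**,
**`DeltaA_inv_mul_pullV`** and the three (1.110) entry operators `entryGrad_mul_pullV` (`∇_ν·Δ_a⁻¹`), `entryGDiv_mul_pullV` (`Δ_a⁻¹·∇_ν*`),
`entryLap_mul_pullV` (`Δ·Δ_a⁻¹`).

HONEST SCOPE.  Finite matrix algebra over the tree's typed operators, used BY NAME; [folklore]∕[our bookkeeping]; nothing of [B5] asserted;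
no estimate.  NOT (E2), NOT (CONV-C), NEVER «G-an2-4 closed», NOT NE2, NOT D1, NOT BetaPertH, NOT continuum, NOT Clay; not in print — our
bookkeeping.  HONEST DEPENDENCY: continuum YM on T⁴ ⇐ BetaPertH ∧ nine spine estimates (0/9 proved); BetaPertH ⇐ (D1) ∧ (D4) ∧ CAP+tail;
G-an2-4 gates asym, D1 and NE2/3/4.
-/

noncomputable section

open scoped BigOperators Matrix ComplexConjugate
open Finset

namespace Summit.QuantumFields.BalabanUV.Beta.GAN24.TorusCoveringOps

open Literature.MathematicalPhysics.QuantumFieldTheory.Balaban1983to89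
open B5Prop11Plancherel (Tor fine unitVec shiftM fdiff)
open B5Action121 (shiftS sdiff LapS GradOp divS shiftS_mulVec shiftS_conjTranspose_mulVec sdiff_mulVec
  sdiff_conjTranspose_mulVec GradOp_mulVec GradOp_conjTranspose_mulVec divS_apply)
open B5G183FreeRowSum (fdiff_mulVec fdiff_conjTranspose_mulVec)
open B5Prop11Lower (Lap)
open B5Block118 (tstep bpt lineSum QsOp QvOp QsOp_mulVec QvOp_mulVec)
open B5Blocks16 (blockOf)
open B5Adjoint130 (QsOp_adjoint_mulVec)
open B5Adjoint176 (QvOp_adjoint_mulVec)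
open B5LaplaceInverse (LapSinv LapS_LapSinv_of_orth LapSinv_LapS_of_orth LapSinv_const sum_LapSinv)
open B5Substitution125 (Mop Cavg Kmat Minv Cavg_mulVec Kmat_isUnit)
open B5Value126 (PcT PcT_mulVec)
open B5DeltaA169 (DeltaA QvAdj isUnit_DeltaA)
open TorusCovering (cov pull pullV cov_add cov_sub cov_add_unitVec cov_sub_unitVec cov_tstep cov_bpt blockOf_cov hfine pull_mulVec
  pullV_mulVec pull_mulVec_const sum_pull_mulVec ker ker_card_eq_div)

variable {d : ℕ}

/-! ## §0 Intertwining algebra -/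

section Generic

variable {k k' l l' m m' : Type*}

/-- an intertwining `A′·P₁ = P₂·A` read on vectors: `A′ (P₁ v) = P₂ (A v)`. [folklore] -/
theorem itw_mulVec [Fintype k] [Fintype m] [Fintype m'] {A' : Matrix k' m' ℂ} {P₁ : Matrix m' m ℂ} {P₂ : Matrix k' k ℂ}
    {A : Matrix k m ℂ} (hA : A' * P₁ = P₂ * A) (v : m → ℂ) : A' *ᵥ (P₁ *ᵥ v) = P₂ *ᵥ (A *ᵥ v) := by
  rw [Matrix.mulVec_mulVec, Matrix.mulVec_mulVec, hA]

/-- an intertwining from its reading on vectors. [folklore] -/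
theorem itw_of_mulVec [Fintype k] [Fintype m] [Fintype m'] {A' : Matrix k' m' ℂ} {P₁ : Matrix m' m ℂ} {P₂ : Matrix k' k ℂ}
    {A : Matrix k m ℂ} (hA : ∀ v, A' *ᵥ (P₁ *ᵥ v) = P₂ *ᵥ (A *ᵥ v)) : A' * P₁ = P₂ * A :=
  Matrix.ext_iff_mulVec.mpr fun v => by rw [← Matrix.mulVec_mulVec, ← Matrix.mulVec_mulVec, hA]

/-- products of intertwiners intertwine. [folklore] -/
theorem itw_mul [Fintype k] [Fintype k'] [Fintype l] [Fintype m'] {B' : Matrix l' k' ℂ} {P₂ : Matrix k' k ℂ} {P₃ : Matrix l' l ℂ}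
    {B : Matrix l k ℂ} {A' : Matrix k' m' ℂ} {P₁ : Matrix m' m ℂ} {A : Matrix k m ℂ}
    (hB : B' * P₂ = P₃ * B) (hA : A' * P₁ = P₂ * A) : B' * A' * P₁ = P₃ * (B * A) := by
  rw [Matrix.mul_assoc, hA, ← Matrix.mul_assoc, hB, Matrix.mul_assoc]

/-- sums of intertwiners intertwine. [folklore] -/
theorem itw_add [Fintype k] [Fintype m'] {A' B' : Matrix k' m' ℂ} {P₁ : Matrix m' m ℂ} {P₂ : Matrix k' k ℂ} {A B : Matrix k m ℂ}
    (hA : A' * P₁ = P₂ * A) (hB : B' * P₁ = P₂ * B) : (A' + B') * P₁ = P₂ * (A + B) := by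
  rw [Matrix.add_mul, Matrix.mul_add, hA, hB]

/-- differences of intertwiners intertwine. [folklore] -/
theorem itw_sub [Fintype k] [Fintype m'] {A' B' : Matrix k' m' ℂ} {P₁ : Matrix m' m ℂ} {P₂ : Matrix k' k ℂ} {A B : Matrix k m ℂ}
    (hA : A' * P₁ = P₂ * A) (hB : B' * P₁ = P₂ * B) : (A' - B') * P₁ = P₂ * (A - B) := by
  rw [Matrix.sub_mul, Matrix.mul_sub, hA, hB]

/-- scalar multiples of intertwiners intertwine. [folklore] -/
theorem itw_smul [Fintype k] [Fintype m'] {A' : Matrix k' m' ℂ} {P₁ : Matrix m' m ℂ} {P₂ : Matrix k' k ℂ} {A : Matrix k m ℂ}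
    (c : ℂ) (hA : A' * P₁ = P₂ * A) : (c • A') * P₁ = P₂ * (c • A) := by
  rw [Matrix.smul_mul, Matrix.mul_smul, hA]

/-- finite sums of intertwiners intertwine. [folklore] -/
theorem itw_sum [Fintype k] [Fintype m'] {ι : Type*} (s : Finset ι) {A' : ι → Matrix k' m' ℂ} {P₁ : Matrix m' m ℂ}
    {P₂ : Matrix k' k ℂ} {A : ι → Matrix k m ℂ} (hA : ∀ i ∈ s, A' i * P₁ = P₂ * A i) :
    (∑ i ∈ s, A' i) * P₁ = P₂ * ∑ i ∈ s, A i := by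
  rw [Matrix.sum_mul, Matrix.mul_sum]
  exact Finset.sum_congr rfl hA

/-- **INVERSES INTERTWINE**: `A′·P = P·A` with `A`, `A′` invertible gives `A′⁻¹·P = P·A⁻¹`. [folklore] -/
theorem itw_inv [Fintype m] [Fintype m'] [DecidableEq m] [DecidableEq m'] {A' : Matrix m' m' ℂ} {P : Matrix m' m ℂ}
    {A : Matrix m m ℂ} (hA : A' * P = P * A) (hA' : IsUnit A') (hAu : IsUnit A) : A'⁻¹ * P = P * A⁻¹ := by
  have h1 := (Matrix.isUnit_iff_isUnit_det _).mp hA'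
  have h2 := (Matrix.isUnit_iff_isUnit_det _).mp hAu
  calc A'⁻¹ * P = A'⁻¹ * P * (A * A⁻¹) := by rw [Matrix.mul_nonsing_inv _ h2, Matrix.mul_one]
    _ = A'⁻¹ * (P * A) * A⁻¹ := by simp only [Matrix.mul_assoc]
    _ = A'⁻¹ * (A' * P) * A⁻¹ := by rw [hA]
    _ = P * A⁻¹ := by rw [← Matrix.mul_assoc, Matrix.nonsing_inv_mul _ h1, Matrix.one_mul]

end Generic

/-! ## §1 Scalar local operators -/

section Scalar

variable {N N' : Fin d → ℕ} [hN : ∀ μ, NeZero (N μ)] [hN' : ∀ μ, NeZero (N' μ)] (h : ∀ μ, N μ ∣ N' μ)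

/-- translations: `S_ν(N′) * pull = pull * S_ν(N)`. [folklore] -/
theorem shiftS_mul_pull (ν : Fin d) : shiftS N' ν * pull h = pull h * shiftS N ν := by
  refine itw_of_mulVec fun f => funext fun x' => ?_
  rw [shiftS_mulVec, pull_mulVec, pull_mulVec, shiftS_mulVec, cov_add_unitVec]

/-- inverse translations: `S_ν(N′)ᴴ * pull = pull * S_ν(N)ᴴ`. [folklore] -/
theorem shiftSH_mul_pull (ν : Fin d) : (shiftS N' ν)ᴴ * pull h = pull h * (shiftS N ν)ᴴ := by
  refine itw_of_mulVec fun f => funext fun x' => ?_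
  rw [shiftS_conjTranspose_mulVec, pull_mulVec, pull_mulVec, shiftS_conjTranspose_mulVec, cov_sub_unitVec]

/-- forward differences: `∂_ν(N′) * pull = pull * ∂_ν(N)` (same lattice factor `c`). [folklore] -/
theorem sdiff_mul_pull (c : ℂ) (ν : Fin d) : sdiff N' c ν * pull h = pull h * sdiff N c ν := by
  refine itw_of_mulVec fun f => funext fun x' => ?_
  rw [sdiff_mulVec, pull_mulVec, pull_mulVec, pull_mulVec, sdiff_mulVec, cov_add_unitVec]

/-- adjoint differences: `∂_ν(N′)ᴴ * pull = pull * ∂_ν(N)ᴴ`. [folklore] -/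
theorem sdiffH_mul_pull (c : ℂ) (ν : Fin d) : (sdiff N' c ν)ᴴ * pull h = pull h * (sdiff N c ν)ᴴ := by
  refine itw_of_mulVec fun f => funext fun x' => ?_
  rw [sdiff_conjTranspose_mulVec, pull_mulVec, pull_mulVec, pull_mulVec, sdiff_conjTranspose_mulVec, cov_sub_unitVec]

/-- the scalar Laplace operator: `Δ(N′) * pull = pull * Δ(N)`. [folklore] -/
theorem LapS_mul_pull (c : ℂ) : LapS N' c * pull h = pull h * LapS N c := by
  unfold LapS
  exact itw_sum _ fun ν _ => itw_mul (sdiffH_mul_pull h c ν) (sdiff_mul_pull h c ν)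

/-- the gradient (scalar → vector): `∂(N′) * pull = pullV * ∂(N)`. [folklore] -/
theorem GradOp_mul_pull (c : ℂ) : GradOp N' c * pull h = pullV h * GradOp N c := by
  refine itw_of_mulVec fun f => funext fun i => ?_
  obtain ⟨x', ν⟩ := i
  rw [GradOp_mulVec, sdiff_mulVec, pull_mulVec, pull_mulVec, pullV_mulVec, GradOp_mulVec, sdiff_mulVec, cov_add_unitVec]

/-- the divergence (vector → scalar): `∂(N′)ᴴ * pullV = pull * ∂(N)ᴴ`. [folklore] -/
theorem GradOpH_mul_pullV (c : ℂ) : (GradOp N' c)ᴴ * pullV h = pull h * (GradOp N c)ᴴ := by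
  refine itw_of_mulVec fun F => funext fun x' => ?_
  rw [GradOp_conjTranspose_mulVec, divS_apply, pull_mulVec, GradOp_conjTranspose_mulVec, divS_apply]
  refine Finset.sum_congr rfl fun μ _ => ?_
  rw [pullV_mulVec, pullV_mulVec, cov_sub_unitVec]

end Scalar

/-! ## §2 Vector local operators -/

section Vector

variable {N N' : Fin d → ℕ} [hN : ∀ μ, NeZero (N μ)] [hN' : ∀ μ, NeZero (N' μ)] (h : ∀ μ, N μ ∣ N' μ)

/-- vector forward differences: `∇_ν(N′) * pullV = pullV * ∇_ν(N)`. [folklore] -/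
theorem fdiff_mul_pullV (c : ℂ) (ν : Fin d) : fdiff N' c ν * pullV h = pullV h * fdiff N c ν := by
  refine itw_of_mulVec fun F => funext fun i => ?_
  simp only [fdiff_mulVec, pullV_mulVec, cov_add_unitVec]

/-- adjoint vector differences: `∇_ν(N′)ᴴ * pullV = pullV * ∇_ν(N)ᴴ`. [folklore] -/
theorem fdiffH_mul_pullV (c : ℂ) (ν : Fin d) : (fdiff N' c ν)ᴴ * pullV h = pullV h * (fdiff N c ν)ᴴ := by
  refine itw_of_mulVec fun F => funext fun i => ?_
  simp only [fdiff_conjTranspose_mulVec, pullV_mulVec, cov_sub_unitVec]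

end Vector

/-! ## §3 Block averages and the mean (spacing `n`, unit tori `M ∣ M′`) -/

section Blocks

variable (n : ℕ) [NeZero n] {M M' : Fin d → ℕ} [hM : ∀ μ, NeZero (M μ)] [hM' : ∀ μ, NeZero (M' μ)] (h : ∀ μ, M μ ∣ M' μ)

/-- the vector Laplacian on the fine tori: `Lap(n, M′) * pullV = pullV * Lap(n, M)`. [folklore] -/
theorem Lap_mul_pullV : Lap n M' * pullV (hfine n h) = pullV (hfine n h) * Lap n M := by
  unfold Lap
  exact itw_sum _ fun ν _ => itw_mul (fdiffH_mul_pullV (hfine n h) _ ν) (fdiff_mul_pullV (hfine n h) _ ν)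

/-- scalar block averages: `Q′(n, M′) * pull(fine) = pull(coarse) * Q′(n, M)`. [folklore] -/
theorem QsOp_mul_pull : QsOp n M' * pull (hfine n h) = pull h * QsOp n M := by
  refine itw_of_mulVec fun f => funext fun y' => ?_
  rw [QsOp_mulVec, pull_mulVec, QsOp_mulVec]
  refine congrArg _ (Finset.sum_congr rfl fun j _ => ?_)
  rw [pull_mulVec, cov_bpt n h]

/-- adjoint scalar block averages: `Q′(n, M′)ᴴ * pull(coarse) = pull(fine) * Q′(n, M)ᴴ`. [folklore] -/
theorem QsOpH_mul_pull : (QsOp n M')ᴴ * pull h = pull (hfine n h) * (QsOp n M)ᴴ := by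
  refine itw_of_mulVec fun ω => funext fun x' => ?_
  rw [QsOp_adjoint_mulVec, pull_mulVec, pull_mulVec, QsOp_adjoint_mulVec, blockOf_cov n h]

/-- vector block averages (1.18): `Q(n, M′) * pullV(fine) = pullV(coarse) * Q(n, M)`. [folklore] -/
theorem QvOp_mul_pullV : QvOp n M' * pullV (hfine n h) = pullV h * QvOp n M := by
  refine itw_of_mulVec fun F => funext fun i => ?_
  obtain ⟨y', μ⟩ := i
  rw [QvOp_mulVec, pullV_mulVec, QvOp_mulVec]
  refine congrArg _ (Finset.sum_congr rfl fun j _ => Finset.sum_congr rfl fun t _ => ?_)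
  rw [pullV_mulVec, cov_add, cov_bpt n h, cov_tstep]

/-- adjoint vector block averages: `Q(n, M′)ᴴ * pullV(coarse) = pullV(fine) * Q(n, M)ᴴ`. [folklore] -/
theorem QvOpH_mul_pullV : (QvOp n M')ᴴ * pullV h = pullV (hfine n h) * (QvOp n M)ᴴ := by
  refine itw_of_mulVec fun G => funext fun i => ?_
  obtain ⟨x', κ⟩ := i
  simp only [QvOp_adjoint_mulVec, pullV_mulVec]
  refine congrArg _ (Finset.sum_congr rfl fun t _ => ?_)
  rw [← cov_tstep (hfine n h) κ t, ← cov_sub, blockOf_cov n h]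

/-- the `η`-normalised adjoint `Q*_k = n^d·Qᴴ`: `Q*(n, M′) * pullV(coarse) = pullV(fine) * Q*(n, M)`. [folklore] -/
theorem QvAdj_mul_pullV : QvAdj n M' * pullV h = pullV (hfine n h) * QvAdj n M := by
  unfold QvAdj
  exact itw_smul _ (QvOpH_mul_pullV n h)

omit [NeZero n] in
/-- the mean: `C(M′) * pull = pull * C(M)` (uniform fibres). [folklore] -/
theorem Cavg_mul_pull : Cavg M' * pull h = pull h * Cavg M := by
  refine itw_of_mulVec fun v => funext fun y' => ?_
  rw [Cavg_mulVec, pull_mulVec, Cavg_mulVec, sum_pull_mulVec, ker_card_eq_div]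
  have h1 : (Fintype.card (Tor M') : ℂ) ≠ 0 := by exact_mod_cast Fintype.card_ne_zero
  have h2 : (Fintype.card (Tor M) : ℂ) ≠ 0 := by exact_mod_cast Fintype.card_ne_zero
  field_simp

end Blocks

/-! ## §4 The scalar `Δ⁻¹` on the complement of constants -/

section LaplaceInverse

variable {N N' : Fin d → ℕ} [hN : ∀ μ, NeZero (N μ)] [hN' : ∀ μ, NeZero (N' μ)] (h : ∀ μ, N μ ∣ N' μ)

/-- `Δ⁻¹` intertwines on mean-zero functions: if `Σ f = 0` then `Δ(N′)⁻¹ (pull f) = pull (Δ(N)⁻¹ f)` — because `u := Δ⁻¹f` is THE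
mean-zero solution of `Δu = f`, and `pull u` is a mean-zero solution of `Δ(pull u) = pull f`. [folklore] -/
theorem LapSinv_pull_of_orth {c : ℂ} (hc : c ≠ 0) (f : Tor N → ℂ) (hf : ∑ x, f x = 0) :
    LapSinv N' c *ᵥ (pull h *ᵥ f) = pull h *ᵥ (LapSinv N c *ᵥ f) := by
  set u := LapSinv N c *ᵥ f with hu
  have hsum_pu : ∑ x', (pull h *ᵥ u) x' = 0 := by rw [sum_pull_mulVec, hu, sum_LapSinv, mul_zero]
  have hL' : LapS N' c *ᵥ (pull h *ᵥ u) = pull h *ᵥ f := by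
    rw [itw_mulVec (LapS_mul_pull h c), hu, LapS_LapSinv_of_orth N hc f hf]
  rw [← hL', LapSinv_LapS_of_orth N' hc _ hsum_pu]

/-- **`Δ⁻¹` INTERTWINES**: `Δ(N′)⁻¹ * pull = pull * Δ(N)⁻¹` (`c ≠ 0`; constants go to `0` on both sides). [folklore] -/
theorem LapSinv_mul_pull {c : ℂ} (hc : c ≠ 0) : LapSinv N' c * pull h = pull h * LapSinv N c := by
  refine itw_of_mulVec fun v => ?_
  set m : ℂ := (∑ x, v x) / Fintype.card (Tor N) with hm
  set v₀ : Tor N → ℂ := fun x => v x - m with hv₀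
  have hsplit : v = v₀ + fun _ => m := by
    funext x; simp only [hv₀, Pi.add_apply, sub_add_cancel]
  have h0 : ∑ x, v₀ x = 0 := by
    have hc0 : (Fintype.card (Tor N) : ℂ) ≠ 0 := by exact_mod_cast Fintype.card_ne_zero
    have hcm : (Fintype.card (Tor N) : ℂ) * m = ∑ x, v x := by
      rw [hm]; field_simp
    simp only [hv₀, Finset.sum_sub_distrib, Finset.sum_const, Finset.card_univ, nsmul_eq_mul, hcm, sub_self]
  rw [hsplit, Matrix.mulVec_add, Matrix.mulVec_add, Matrix.mulVec_add, pull_mulVec_const, LapSinv_const, LapSinv_const,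
    add_zero, add_zero, LapSinv_pull_of_orth h hc _ h0]

end LaplaceInverse

/-! ## §5 `Q′Δ⁻²Q′*`, `K = Q′Δ⁻²Q′* + C`, its inverse, and the projection `P = Δ⁻¹Q′*(Q′Δ⁻²Q′*)⁻¹Q′Δ⁻¹` -/

section Projection

variable (n : ℕ) [NeZero n] {M M' : Fin d → ℕ} [hM : ∀ μ, NeZero (M μ)] [hM' : ∀ μ, NeZero (M' μ)] (h : ∀ μ, M μ ∣ M' μ)

/-- `Mop(n, M′) * pull = pull * Mop(n, M)` (`c ≠ 0`). [folklore] -/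
theorem Mop_mul_pull {c : ℂ} (hc : c ≠ 0) : Mop n M' c * pull h = pull h * Mop n M c := by
  unfold Mop
  exact itw_mul (itw_mul (QsOp_mul_pull n h) (itw_mul (LapSinv_mul_pull (hfine n h) hc) (LapSinv_mul_pull (hfine n h) hc)))
    (QsOpH_mul_pull n h)

/-- `K(n, M′) * pull = pull * K(n, M)` (`c ≠ 0`). [folklore] -/
theorem Kmat_mul_pull {c : ℂ} (hc : c ≠ 0) : Kmat n M' c * pull h = pull h * Kmat n M c := by
  unfold Kmat
  exact itw_add (Mop_mul_pull n h hc) (Cavg_mul_pull h)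

/-- **`(Q′Δ⁻²Q′* + C)⁻¹` INTERTWINES**: `Minv(n, M′) * pull = pull * Minv(n, M)` (`c ≠ 0`). [folklore] -/
theorem Minv_mul_pull {c : ℂ} (hc : c ≠ 0) : Minv n M' c * pull h = pull h * Minv n M c := by
  unfold Minv
  exact itw_inv (Kmat_mul_pull n h hc) (Kmat_isUnit n M' c hc) (Kmat_isUnit n M c hc)

/-- **THE PROJECTION `P = PcT` INTERTWINES**: `P(n, M′) * pull = pull * P(n, M)` (`c ≠ 0`). [folklore] -/
theorem PcT_mul_pull {c : ℂ} (hc : c ≠ 0) : PcT n M' c * pull (hfine n h) = pull (hfine n h) * PcT n M c := by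
  refine itw_of_mulVec fun b => ?_
  rw [PcT_mulVec, PcT_mulVec, itw_mulVec (LapSinv_mul_pull (hfine n h) hc), itw_mulVec (QsOp_mul_pull n h),
    itw_mulVec (Minv_mul_pull n h hc), itw_mulVec (QsOpH_mul_pull n h), itw_mulVec (LapSinv_mul_pull (hfine n h) hc)]

end Projection

/-! ## §6 `Δ_a`, its inverse, and the (1.110) entry operators -/

section DeltaA

variable (n : ℕ) [NeZero n] {M M' : Fin d → ℕ} [hM : ∀ μ, NeZero (M μ)] [hM' : ∀ μ, NeZero (M' μ)] (h : ∀ μ, M μ ∣ M' μ)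
  (a : ℝ)

/-- **`Δ_a` INTERTWINES WITH THE PULL-BACK OF ANY COVERING**: `DeltaA n M′ a * pullV = pullV * DeltaA n M a`. [folklore] -/
theorem DeltaA_mul_pullV : DeltaA n M' a * pullV (hfine n h) = pullV (hfine n h) * DeltaA n M a := by
  have hn : (n : ℂ) ≠ 0 := by exact_mod_cast NeZero.ne n
  unfold DeltaA
  exact itw_add (itw_sub (Lap_mul_pullV n h)
    (itw_mul (itw_mul (GradOp_mul_pull (hfine n h) _) (PcT_mul_pull n h hn)) (GradOpH_mul_pullV (hfine n h) _)))
    (itw_smul _ (itw_mul (QvAdj_mul_pullV n h) (QvOp_mul_pullV n h)))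

/-- **THE PROPAGATOR INTERTWINES**: `(DeltaA n M′ a)⁻¹ * pullV = pullV * (DeltaA n M a)⁻¹` for `1 ≤ n`, `0 < a` — `G = Δ_a⁻¹` on ANY torus
`M` is the restriction along the covering of `G` on any torus `M′` that `M` divides. [folklore] -/
theorem DeltaA_inv_mul_pullV (hn : 1 ≤ n) (ha : 0 < a) :
    (DeltaA n M' a)⁻¹ * pullV (hfine n h) = pullV (hfine n h) * (DeltaA n M a)⁻¹ :=
  itw_inv (DeltaA_mul_pullV n h a) (isUnit_DeltaA n hn M' a ha) (isUnit_DeltaA n hn M a ha)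

/-- the (1.110) second-entry operator `∇_ν·Δ_a⁻¹` intertwines. [folklore] -/
theorem entryGrad_mul_pullV (hn : 1 ≤ n) (ha : 0 < a) (ν : Fin d) :
    fdiff (fine n M') (n : ℂ) ν * (DeltaA n M' a)⁻¹ * pullV (hfine n h)
      = pullV (hfine n h) * (fdiff (fine n M) (n : ℂ) ν * (DeltaA n M a)⁻¹) :=
  itw_mul (fdiff_mul_pullV (hfine n h) _ ν) (DeltaA_inv_mul_pullV n h a hn ha)

/-- the (1.110) third-entry operator `Δ_a⁻¹·∇_ν*` intertwines. [folklore] -/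
theorem entryGDiv_mul_pullV (hn : 1 ≤ n) (ha : 0 < a) (ν : Fin d) :
    (DeltaA n M' a)⁻¹ * (fdiff (fine n M') (n : ℂ) ν)ᴴ * pullV (hfine n h)
      = pullV (hfine n h) * ((DeltaA n M a)⁻¹ * (fdiff (fine n M) (n : ℂ) ν)ᴴ) :=
  itw_mul (DeltaA_inv_mul_pullV n h a hn ha) (fdiffH_mul_pullV (hfine n h) _ ν)

/-- the (1.110) fourth-entry operator `Δ·Δ_a⁻¹` intertwines. [folklore] -/
theorem entryLap_mul_pullV (hn : 1 ≤ n) (ha : 0 < a) :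
    Lap n M' * (DeltaA n M' a)⁻¹ * pullV (hfine n h) = pullV (hfine n h) * (Lap n M * (DeltaA n M a)⁻¹) :=
  itw_mul (Lap_mul_pullV n h) (DeltaA_inv_mul_pullV n h a hn ha)

end DeltaA

end Summit.QuantumFields.BalabanUV.Beta.GAN24.TorusCoveringOps

end
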